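import Summits.Ventures.PercRepro.SixThreeLam

/-!
# PercRepro — profile counts of a plane: the rank-`≤ 2` subsets are partitioned by the lines (p2, gen 6)

mine-2's `MINE2-RLS.md` §19.7 Step 2 expresses every count entering the planar inequalities `(I_t)` through the
LINE PROFILE `{m_ℓ = |ℓ ∩ G|}` of the plane `G`: for `s ≥ 2` the `s`-subsets of `G` of rank `≤ 2` are exactly the
`s`-subsets of a line of `M|G`, each lying in ONE line (two lines share at most one point), so

    #{X ⊆ G : |X| = s, ρ(X) ≤ 2} = Σ_ℓ C(m_ℓ, s)   and   N_s := #{X ⊆ G : |X| = s, ρ(X) = 3} = C(g, s) − Σ_ℓ C(m_ℓ, s).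

`card_low_subsets` is the first identity (`sum_choose_linesOf` is its case `s = 2`), `card_rank_three_subsets_add`
the second in additive form.
-/

namespace PercRepro

namespace SixThree

open Finset ThmH

variable {α : Type*} [DecidableEq α] {M : Matroid α} [M.Finite]

omit [DecidableEq α] in
/-- An `s`-subset (`s ≥ 2`) of the ground set of rank `≤ 2` has rank exactly `2` (simple matroid). -/
theorem eRk_eq_two_of_le_two (hs : Simple M) {X : Finset α} (hX : X ⊆ gr M) (hX2 : 2 ≤ X.card)
    (hr : M.eRk (X : Set α) ≤ 2) : M.eRk (X : Set α) = 2 := by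
  obtain ⟨a, ha, b, hb, hab⟩ := Finset.one_lt_card.1 hX2
  exact le_antisymm hr (two_le_eRk_of_two_mem hs hX ha hb hab)

/-- **The rank-`≤ 2` `s`-subsets of `B` are partitioned by the lines of `M|B`** (`s ≥ 2`):
`#{X ⊆ B : |X| = s, ρ(X) ≤ 2} = Σ_{L ∈ linesOf B} C(|L ∩ B|, s)`. -/
theorem card_low_subsets (hs : Simple M) {B : Finset α} (hB : B ⊆ gr M) {s : ℕ} (hs2 : 2 ≤ s) :
    ((B.powersetCard s).filter (fun X : Finset α => M.eRk ((X : Finset α) : Set α) ≤ 2)).card =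
      ∑ L ∈ linesOf M B, ((L ∩ B).card).choose s := by
  classical
  set Low := (B.powersetCard s).filter (fun X : Finset α => M.eRk ((X : Finset α) : Set α) ≤ 2) with hLow
  have hLowdata : ∀ X ∈ Low, X ⊆ B ∧ X.card = s ∧ M.eRk (X : Set α) = 2 := by
    intro X hX
    rw [hLow, Finset.mem_filter, Finset.mem_powersetCard] at hX
    exact ⟨hX.1.1, hX.1.2, eRk_eq_two_of_le_two hs (hX.1.1.trans hB) (hX.1.2 ▸ hs2) hX.2⟩
  have hmaps : ∀ X ∈ Low, clF M X ∈ linesOf M B := by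
    intro X hX
    obtain ⟨hXB, hXs, hr2⟩ := hLowdata X hX
    obtain ⟨hL, hsub⟩ := clF_mem_lines (hXB.trans hB) hr2
    unfold linesOf
    rw [Finset.mem_filter]
    refine ⟨hL, ?_⟩
    calc 2 ≤ X.card := hXs ▸ hs2
      _ ≤ (clF M X ∩ B).card := Finset.card_le_card (Finset.subset_inter hsub hXB)
  rw [Finset.card_eq_sum_card_fiberwise hmaps]
  apply Finset.sum_congr rfl
  intro L hL
  rw [← Finset.card_powersetCard s (L ∩ B)]
  congr 1
  ext X
  rw [Finset.mem_filter, Finset.mem_powersetCard]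
  constructor
  · rintro ⟨hX, hXL⟩
    obtain ⟨hXB, hXs, -⟩ := hLowdata X hX
    refine ⟨?_, hXs⟩
    have hsub : X ⊆ clF M X := (clF_mem_lines (hXB.trans hB) (hLowdata X hX).2.2).2
    rw [hXL] at hsub
    exact Finset.subset_inter hsub hXB
  · rintro ⟨hXLB, hXs⟩
    have hL' : L ∈ lines M := (Finset.mem_filter.1 hL).1
    have hXL : X ⊆ L := hXLB.trans Finset.inter_subset_left
    have hXB : X ⊆ B := hXLB.trans Finset.inter_subset_right
    have hr2 : M.eRk (X : Set α) = 2 := eRk_eq_two_of_subset_line hs hL' hXL (hXs ▸ hs2)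
    refine ⟨?_, ?_⟩
    · rw [hLow, Finset.mem_filter, Finset.mem_powersetCard]
      exact ⟨⟨hXB, hXs⟩, hr2.le⟩
    · apply Finset.coe_injective
      rw [coe_clF]
      exact closure_eq_of_subset_line hL' hXL hr2

/-- **`N_s + Σ_ℓ C(m_ℓ, s) = C(g, s)`** (`s ≥ 2`): the rank-`3` `s`-subsets of a rank-`3` set `G` together with the
`s`-subsets of its lines are all its `s`-subsets. -/
theorem card_rank_three_subsets_add (hs : Simple M) {G : Finset α} (hG : G ⊆ gr M)
    (hrG : M.eRk (G : Set α) = 3) {s : ℕ} (hs2 : 2 ≤ s) :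
    ((G.powersetCard s).filter (fun X : Finset α => M.eRk ((X : Finset α) : Set α) = 3)).card +
      ∑ L ∈ linesOf M G, ((L ∩ G).card).choose s = G.card.choose s := by
  rw [← card_low_subsets hs hG hs2, ← Finset.card_powersetCard s G,
    ← Finset.card_filter_add_card_filter_not (s := G.powersetCard s)
      (p := fun X : Finset α => M.eRk ((X : Finset α) : Set α) = 3)]
  congr 1
  apply Finset.card_bij (fun X _ => X)
  · intro X hX
    rw [Finset.mem_filter, Finset.mem_powersetCard] at hX ⊢
    refine ⟨hX.1, ?_⟩
    intro h3
    rw [h3] at hX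
    exact absurd hX.2 (by decide)
  · intro X _ Y _ h
    exact h
  · intro X hX
    refine ⟨X, ?_, rfl⟩
    rw [Finset.mem_filter, Finset.mem_powersetCard] at hX ⊢
    refine ⟨hX.1, ?_⟩
    have hle3 : M.eRk (X : Set α) ≤ 3 := by
      rw [← hrG]; exact M.eRk_mono (Finset.coe_subset.2 hX.1.1)
    obtain ⟨k, hk, -⟩ := eRk_eq_nat M X
    rw [hk] at hle3 hX ⊢
    have hk3 : k ≤ 3 := by exact_mod_cast hle3
    have hk3' : k ≠ 3 := fun h => hX.2 (by rw [h]; rfl)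
    exact_mod_cast (show k ≤ 2 by omega)

/-! ### Line + point sets -/

/-- Two lines of `M|G` each containing `s − 1 ≥ 3` points of an `s`-set `X` coincide. -/
theorem lines_eq_of_card_inter (hs : Simple M) {G X L L' : Finset α} (hL : L ∈ linesOf M G) (hL' : L' ∈ linesOf M G)
    {s : ℕ} (hs4 : 4 ≤ s) (hX : X.card = s) (hLX : s - 1 ≤ (L ∩ X).card) (hL'X : s - 1 ≤ (L' ∩ X).card) :
    L = L' := by
  have h := Finset.card_union_add_card_inter (L ∩ X) (L' ∩ X)
  have hun : ((L ∩ X) ∪ (L' ∩ X)).card ≤ s := by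
    rw [← hX]
    exact Finset.card_le_card (Finset.union_subset Finset.inter_subset_right Finset.inter_subset_right)
  have h2 : 2 ≤ (L ∩ X ∩ (L' ∩ X)).card := by omega
  obtain ⟨u, hu, v, hv, huv⟩ := Finset.one_lt_card.1 h2
  simp only [Finset.mem_inter] at hu hv
  exact lines_eq_of_two_mem hs (Finset.mem_filter.1 hL).1 (Finset.mem_filter.1 hL').1 hu.1.1 hv.1.1 hu.2.1 hv.2.1 huv

/-- **The «line + point» `s`-sets** (`s ≥ 4`): the `s`-subsets of `G` having a line through `s − 1` of their points
number `Σ_ℓ (g − m_ℓ) · C(m_ℓ, s − 1)` (the line is unique; the set is `Y ∪ {p}` with `Y ⊆ ℓ ∩ G`, `p ∈ G ∖ ℓ`). -/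
theorem card_lp_subsets (hs : Simple M) {G : Finset α} {s : ℕ} (hs4 : 4 ≤ s) :
    ((G.powersetCard s).filter (fun X : Finset α => ∃ L ∈ linesOf M G, (L ∩ X).card = s - 1)).card =
      ∑ L ∈ linesOf M G, (G.card - (L ∩ G).card) * ((L ∩ G).card).choose (s - 1) := by
  classical
  -- the index set: a line, an `(s−1)`-subset of its trace, a point of `G` off the line
  set I : Finset (Σ _ : Finset α, Finset α × α) :=
    (linesOf M G).sigma (fun L => ((L ∩ G).powersetCard (s - 1)) ×ˢ (G \ L)) with hI
  have hIcard : I.card = ∑ L ∈ linesOf M G, (G.card - (L ∩ G).card) * ((L ∩ G).card).choose (s - 1) := by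
    rw [hI, Finset.card_sigma]
    apply Finset.sum_congr rfl
    intro L _
    rw [Finset.card_product, Finset.card_powersetCard, Finset.card_sdiff]
    ring
  have hIdata : ∀ q ∈ I, q.1 ∈ linesOf M G ∧ q.2.1 ⊆ q.1 ∩ G ∧ q.2.1.card = s - 1 ∧ q.2.2 ∈ G ∧ q.2.2 ∉ q.1 := by
    intro q hq
    rw [hI, Finset.mem_sigma, Finset.mem_product, Finset.mem_powersetCard, Finset.mem_sdiff] at hq
    exact ⟨hq.1, hq.2.1.1, hq.2.1.2, hq.2.2.1, hq.2.2.2⟩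
  -- the trace of the image on its line is the `(s−1)`-set
  have htrace : ∀ q ∈ I, q.1 ∩ insert q.2.2 q.2.1 = q.2.1 := by
    intro q hq
    obtain ⟨-, hY, -, -, hp⟩ := hIdata q hq
    ext y
    rw [Finset.mem_inter, Finset.mem_insert]
    constructor
    · rintro ⟨hyL, rfl | hyY⟩
      · exact absurd hyL hp
      · exact hyY
    · intro hyY
      exact ⟨(Finset.mem_inter.1 (hY hyY)).1, Or.inr hyY⟩
  have hcardψ : ∀ q ∈ I, (insert q.2.2 q.2.1).card = s := by
    intro q hq
    obtain ⟨-, hY, hYs, -, hp⟩ := hIdata q hq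
    rw [Finset.card_insert_of_notMem (fun h => hp (Finset.mem_inter.1 (hY h)).1), hYs]
    omega
  rw [← hIcard]
  symm
  apply Finset.card_bij (fun q _ => insert q.2.2 q.2.1)
  · intro q hq
    obtain ⟨hL, hY, hYs, hpG, hp⟩ := hIdata q hq
    rw [Finset.mem_filter, Finset.mem_powersetCard]
    refine ⟨⟨Finset.insert_subset hpG (hY.trans Finset.inter_subset_right), hcardψ q hq⟩, q.1, hL, ?_⟩
    rw [htrace q hq, hYs]
  · intro q hq q' hq' h
    obtain ⟨hL, hY, hYs, hpG, hp⟩ := hIdata q hq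
    obtain ⟨hL', hY', hYs', hpG', hp'⟩ := hIdata q' hq'
    -- the lines coincide
    have hLeq : q.1 = q'.1 := by
      apply lines_eq_of_card_inter hs hL hL' hs4 (hcardψ q hq)
      · rw [htrace q hq, hYs]
      · rw [h, htrace q' hq', hYs']
    -- the traces coincide, hence the points
    have hYeq : q.2.1 = q'.2.1 := by
      rw [← htrace q hq, ← htrace q' hq', hLeq, h]
    have hpeq : q.2.2 = q'.2.2 := by
      have h1 : q.2.2 ∈ insert q'.2.2 q'.2.1 := by rw [← h]; exact Finset.mem_insert_self _ _
      rw [Finset.mem_insert] at h1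
      rcases h1 with h1 | h1
      · exact h1
      · exact absurd (Finset.mem_inter.1 (hY' h1)).1 (hLeq ▸ hp)
    obtain ⟨L, Y, p⟩ := q
    obtain ⟨L', Y', p'⟩ := q'
    simp only at hLeq hYeq hpeq
    subst hLeq hYeq hpeq
    rfl
  · intro X hX
    rw [Finset.mem_filter, Finset.mem_powersetCard] at hX
    obtain ⟨⟨hXG, hXs⟩, L, hL, hLX⟩ := hX
    -- the point off the line
    have hoff : (X \ L).card = 1 := by
      have h := Finset.card_sdiff_add_card_inter X L
      rw [Finset.inter_comm, hLX, hXs] at h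
      omega
    obtain ⟨p, hp⟩ := Finset.card_eq_one.1 hoff
    have hpX : p ∈ X ∧ p ∉ L := by
      have : p ∈ X \ L := by rw [hp]; exact Finset.mem_singleton_self _
      exact Finset.mem_sdiff.1 this
    refine ⟨⟨L, (L ∩ X, p)⟩, ?_, ?_⟩
    · rw [hI, Finset.mem_sigma, Finset.mem_product, Finset.mem_powersetCard, Finset.mem_sdiff]
      exact ⟨hL, ⟨Finset.inter_subset_inter (Finset.Subset.refl _) hXG, hLX⟩, hXG hpX.1, hpX.2⟩
    · show insert p (L ∩ X) = X
      ext y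
      rw [Finset.mem_insert, Finset.mem_inter]
      constructor
      · rintro (rfl | ⟨-, hyX⟩)
        · exact hpX.1
        · exact hyX
      · intro hyX
        by_cases hyL : y ∈ L
        · exact Or.inr ⟨hyL, hyX⟩
        · left
          have : y ∈ X \ L := Finset.mem_sdiff.2 ⟨hyX, hyL⟩
          rw [hp, Finset.mem_singleton] at this
          exact this

/-! ### Line + `j` points -/

/-- Two lines of `M|G` each containing `s − j` points of an `s`-set `X`, with `2j + 2 ≤ s`, coincide. -/
theorem lines_eq_of_card_inter' (hs : Simple M) {G X L L' : Finset α} (hL : L ∈ linesOf M G) (hL' : L' ∈ linesOf M G)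
    {s j : ℕ} (hsj : 2 * j + 2 ≤ s) (hX : X.card = s) (hLX : s - j ≤ (L ∩ X).card) (hL'X : s - j ≤ (L' ∩ X).card) :
    L = L' := by
  have h := Finset.card_union_add_card_inter (L ∩ X) (L' ∩ X)
  have hun : ((L ∩ X) ∪ (L' ∩ X)).card ≤ s := by
    rw [← hX]
    exact Finset.card_le_card (Finset.union_subset Finset.inter_subset_right Finset.inter_subset_right)
  have h2 : 2 ≤ (L ∩ X ∩ (L' ∩ X)).card := by omega
  obtain ⟨u, hu, v, hv, huv⟩ := Finset.one_lt_card.1 h2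
  simp only [Finset.mem_inter] at hu hv
  exact lines_eq_of_two_mem hs (Finset.mem_filter.1 hL).1 (Finset.mem_filter.1 hL').1 hu.1.1 hv.1.1 hu.2.1 hv.2.1 huv

/-- **The «line + `j` points» `s`-sets** (`2j + 2 ≤ s`): the `s`-subsets of `G` having a line through exactly `s − j`
of their points number `Σ_ℓ C(m_ℓ, s − j) · C(g − m_ℓ, j)` (the line is unique; the set is `Y ∪ Z` with
`Y ⊆ ℓ ∩ G`, `|Y| = s − j`, `Z ⊆ G ∖ ℓ`, `|Z| = j`).  `j = 1` are the lp sets, `j = 2` the `(s − 2)`-type sets of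
mine-2 §19.7 Step 2 (`d_s`). -/
theorem card_line_plus_subsets (hs : Simple M) {G : Finset α} {s j : ℕ} (hsj : 2 * j + 2 ≤ s) :
    ((G.powersetCard s).filter (fun X : Finset α => ∃ L ∈ linesOf M G, (L ∩ X).card = s - j)).card =
      ∑ L ∈ linesOf M G, ((L ∩ G).card).choose (s - j) * (G.card - (L ∩ G).card).choose j := by
  classical
  set I : Finset (Σ _ : Finset α, Finset α × Finset α) :=
    (linesOf M G).sigma (fun L => ((L ∩ G).powersetCard (s - j)) ×ˢ ((G \ L).powersetCard j)) with hI
  have hIcard : I.card = ∑ L ∈ linesOf M G, ((L ∩ G).card).choose (s - j) * (G.card - (L ∩ G).card).choose j := by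
    rw [hI, Finset.card_sigma]
    apply Finset.sum_congr rfl
    intro L _
    rw [Finset.card_product, Finset.card_powersetCard, Finset.card_powersetCard, Finset.card_sdiff]
  have hIdata : ∀ q ∈ I, q.1 ∈ linesOf M G ∧ q.2.1 ⊆ q.1 ∩ G ∧ q.2.1.card = s - j ∧ q.2.2 ⊆ G \ q.1 ∧
      q.2.2.card = j := by
    intro q hq
    rw [hI, Finset.mem_sigma, Finset.mem_product, Finset.mem_powersetCard, Finset.mem_powersetCard] at hq
    exact ⟨hq.1, hq.2.1.1, hq.2.1.2, hq.2.2.1, hq.2.2.2⟩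
  have hdisj : ∀ q ∈ I, Disjoint q.2.1 q.2.2 := by
    intro q hq
    obtain ⟨-, hY, -, hZ, -⟩ := hIdata q hq
    rw [Finset.disjoint_left]
    intro y hyY hyZ
    exact (Finset.mem_sdiff.1 (hZ hyZ)).2 (Finset.mem_inter.1 (hY hyY)).1
  have htrace : ∀ q ∈ I, q.1 ∩ (q.2.1 ∪ q.2.2) = q.2.1 := by
    intro q hq
    obtain ⟨-, hY, -, hZ, -⟩ := hIdata q hq
    ext y
    rw [Finset.mem_inter, Finset.mem_union]
    constructor
    · rintro ⟨hyL, hyY | hyZ⟩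
      · exact hyY
      · exact absurd hyL (Finset.mem_sdiff.1 (hZ hyZ)).2
    · intro hyY
      exact ⟨(Finset.mem_inter.1 (hY hyY)).1, Or.inl hyY⟩
  have hcardψ : ∀ q ∈ I, (q.2.1 ∪ q.2.2).card = s := by
    intro q hq
    obtain ⟨-, -, hYs, -, hZs⟩ := hIdata q hq
    rw [Finset.card_union_of_disjoint (hdisj q hq), hYs, hZs]
    omega
  rw [← hIcard]
  symm
  apply Finset.card_bij (fun q _ => q.2.1 ∪ q.2.2)
  · intro q hq
    obtain ⟨hL, hY, hYs, hZ, hZs⟩ := hIdata q hq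
    rw [Finset.mem_filter, Finset.mem_powersetCard]
    refine ⟨⟨Finset.union_subset (hY.trans Finset.inter_subset_right) (hZ.trans Finset.sdiff_subset),
      hcardψ q hq⟩, q.1, hL, ?_⟩
    rw [htrace q hq, hYs]
  · intro q hq q' hq' h
    obtain ⟨hL, hY, hYs, hZ, hZs⟩ := hIdata q hq
    obtain ⟨hL', hY', hYs', hZ', hZs'⟩ := hIdata q' hq'
    have hLeq : q.1 = q'.1 := by
      apply lines_eq_of_card_inter' hs hL hL' hsj (hcardψ q hq)
      · rw [htrace q hq, hYs]
      · rw [h, htrace q' hq', hYs']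
    have hYeq : q.2.1 = q'.2.1 := by
      rw [← htrace q hq, ← htrace q' hq', hLeq, h]
    have hZeq : q.2.2 = q'.2.2 := by
      have h1 : q.2.2 = (q.2.1 ∪ q.2.2) \ q.2.1 := by
        rw [Finset.union_sdiff_left, Finset.sdiff_eq_self_of_disjoint (hdisj q hq).symm]
      have h2 : q'.2.2 = (q'.2.1 ∪ q'.2.2) \ q'.2.1 := by
        rw [Finset.union_sdiff_left, Finset.sdiff_eq_self_of_disjoint (hdisj q' hq').symm]
      rw [h1, h2, h, hYeq]
    obtain ⟨L, Y, Z⟩ := q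
    obtain ⟨L', Y', Z'⟩ := q'
    simp only at hLeq hYeq hZeq
    subst hLeq hYeq hZeq
    rfl
  · intro X hX
    rw [Finset.mem_filter, Finset.mem_powersetCard] at hX
    obtain ⟨⟨hXG, hXs⟩, L, hL, hLX⟩ := hX
    refine ⟨⟨L, (L ∩ X, X \ L)⟩, ?_, ?_⟩
    · rw [hI, Finset.mem_sigma, Finset.mem_product, Finset.mem_powersetCard, Finset.mem_powersetCard]
      refine ⟨hL, ⟨Finset.inter_subset_inter (Finset.Subset.refl _) hXG, hLX⟩,
        Finset.sdiff_subset_sdiff hXG (Finset.Subset.refl _), ?_⟩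
      show (X \ L).card = j
      have h := Finset.card_sdiff_add_card_inter X L
      rw [Finset.inter_comm, hLX, hXs] at h
      omega
    · show (L ∩ X) ∪ (X \ L) = X
      ext y
      rw [Finset.mem_union, Finset.mem_inter, Finset.mem_sdiff]
      constructor
      · rintro (⟨-, hyX⟩ | ⟨hyX, -⟩) <;> exact hyX
      · intro hyX
        by_cases hyL : y ∈ L
        · exact Or.inl ⟨hyL, hyX⟩
        · exact Or.inr ⟨hyX, hyL⟩

/-- **The «line + `j` points» upper bound** (any `j ≤ s`, no uniqueness): the `s`-subsets of `G` having a line through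
`s − j` of their points number at most `Σ_ℓ C(m_ℓ, s − j) · C(g − m_ℓ, j)` (every such set is `Y ∪ Z` for some
`(ℓ, Y, Z)`; mine-2's `d_5 ≤ …`). -/
theorem card_line_plus_subsets_le {G : Finset α} {s j : ℕ} (hj : j ≤ s) :
    ((G.powersetCard s).filter (fun X : Finset α => ∃ L ∈ linesOf M G, (L ∩ X).card = s - j)).card ≤
      ∑ L ∈ linesOf M G, ((L ∩ G).card).choose (s - j) * (G.card - (L ∩ G).card).choose j := by
  classical
  set I : Finset (Σ _ : Finset α, Finset α × Finset α) :=
    (linesOf M G).sigma (fun L => ((L ∩ G).powersetCard (s - j)) ×ˢ ((G \ L).powersetCard j)) with hI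
  have hIcard : I.card = ∑ L ∈ linesOf M G, ((L ∩ G).card).choose (s - j) * (G.card - (L ∩ G).card).choose j := by
    rw [hI, Finset.card_sigma]
    apply Finset.sum_congr rfl
    intro L _
    rw [Finset.card_product, Finset.card_powersetCard, Finset.card_powersetCard, Finset.card_sdiff]
  rw [← hIcard]
  apply Finset.card_le_card_of_surjOn (fun q => q.2.1 ∪ q.2.2)
  intro X hX
  rw [Finset.mem_coe, Finset.mem_filter, Finset.mem_powersetCard] at hX
  obtain ⟨⟨hXG, hXs⟩, L, hL, hLX⟩ := hX
  refine ⟨⟨L, (L ∩ X, X \ L)⟩, ?_, ?_⟩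
  · rw [Finset.mem_coe, hI, Finset.mem_sigma, Finset.mem_product, Finset.mem_powersetCard,
      Finset.mem_powersetCard]
    refine ⟨hL, ⟨Finset.inter_subset_inter (Finset.Subset.refl _) hXG, hLX⟩,
      Finset.sdiff_subset_sdiff hXG (Finset.Subset.refl _), ?_⟩
    show (X \ L).card = j
    have h := Finset.card_sdiff_add_card_inter X L
    rw [Finset.inter_comm, hLX, hXs] at h
    omega
  · show (L ∩ X) ∪ (X \ L) = X
    ext y
    rw [Finset.mem_union, Finset.mem_inter, Finset.mem_sdiff]
    constructor
    · rintro (⟨-, hyX⟩ | ⟨hyX, -⟩) <;> exact hyX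
    · intro hyX
      by_cases hyL : y ∈ L
      · exact Or.inl ⟨hyL, hyX⟩
      · exact Or.inr ⟨hyX, hyL⟩

/-- An `s`-subset of a plane with a line through `s − 1 ≥ 2` of its points and one point off the line has rank `3`. -/
theorem eRk_eq_three_of_lp (hs : Simple M) {G X L : Finset α} (hG : G ∈ planes M) (hX : X ⊆ G)
    (hL : L ∈ linesOf M G) {s : ℕ} (hs3 : 3 ≤ s) (hXs : X.card = s) (hLX : (L ∩ X).card = s - 1) :
    M.eRk (X : Set α) = 3 := by
  have hL' : L ∈ lines M := (Finset.mem_filter.1 hL).1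
  have hoff : (X \ L).card = 1 := by
    have h := Finset.card_sdiff_add_card_inter X L
    rw [Finset.inter_comm, hLX, hXs] at h
    omega
  obtain ⟨p, hp⟩ := Finset.card_eq_one.1 hoff
  have hpX : p ∈ X ∧ p ∉ L := by
    have : p ∈ X \ L := by rw [hp]; exact Finset.mem_singleton_self _
    exact Finset.mem_sdiff.1 this
  have hXeq : X = insert p (L ∩ X) := by
    ext y
    rw [Finset.mem_insert, Finset.mem_inter]
    constructor
    · intro hyX
      by_cases hyL : y ∈ L
      · exact Or.inr ⟨hyL, hyX⟩
      · left
        have : y ∈ X \ L := Finset.mem_sdiff.2 ⟨hyX, hyL⟩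
        rw [hp, Finset.mem_singleton] at this
        exact this
    · rintro (rfl | ⟨-, hyX⟩)
      · exact hpX.1
      · exact hyX
  have hpg : p ∈ gr M := (mem_planes.1 hG).1 (hX hpX.1)
  rw [hXeq]
  exact eRk_insert_eq_three hs hL' Finset.inter_subset_left (by omega) hpg hpX.2

end SixThree

end PercRepro
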